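import Literature.NumberTheory.LFunctions.FordLemma32
import HarnessLib

/-!
# Ford's Lemma 3.3, part A: the counts `L^{(j)}`, their integral representation, and the case `U₀`

Topic `Literature/NumberTheory/LFunctions`. Everything here is PROVED.

K. Ford, Proc. LMS 85 (2002), proof of Lemma 3.3, first half: with
`I(α) = ∑_c |∑_{w ≡ c (p^r)} e(α·Φ(w))|²` one has `L^{(j)} = ∫ I^j |f|^{2s}` for the number `L^{(j)}`
of solutions of (3.2) with `j` congruent pairs `(z_i,w_i)`; the solutions with some `w_i = z_i`
number `U₀ ≤ k P L^{(k−1)} ≤ k P L^{1−1/k} J_{s,k}(Q)^{1/k}` (Hölder).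

## References

* K. Ford, Proc. London Math. Soc. (3) 85 (2002), 565–633, Lemma 3.3 and its proof. [Ford2002]
-/

noncomputable section

open Finset MeasureTheory Polynomial Complex
open scoped Real ComplexConjugate

namespace Literature.NumberTheory.LFunctions
namespace FordVK

open VMV

section LCounts

variable {k : ℕ} (s P Q : ℕ) (Φ : PSystem k) (q : ℤ) (p r : ℕ)

/-- The frequency of `(z,x)` with `j` variables `z_i`: `∑_i Φ(z_i) + q^ℓ ∑ x_i^ℓ`. [cite: Ford2002, (3.2)] -/
def LfreqJ (j : ℕ) (a : (Fin j → ℤ) × (Fin s → ℤ)) : Fin k → ℤ := tupSum (sysv Φ) a.1 + tupSum (powv k q) a.2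

/-- The solution set of (3.2) with `j` congruent pairs (moduli `q`, congruences `mod p^r`). [cite: Ford2002, (3.2)] -/
def LIset (j : ℕ) : Finset (((Fin j → ℤ) × (Fin s → ℤ)) × ((Fin j → ℤ) × (Fin s → ℤ))) :=
  (((tuples j (Finset.Icc 1 (P : ℤ))) ×ˢ tuples s (Finset.Icc 1 (Q : ℤ)))
      ×ˢ ((tuples j (Finset.Icc 1 (P : ℤ))) ×ˢ tuples s (Finset.Icc 1 (Q : ℤ)))).filter fun a =>
    LfreqJ s Φ q j a.1 = LfreqJ s Φ q j a.2 ∧ ∀ i, ((p : ℤ) ^ r) ∣ a.1.1 i - a.2.1 i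

/-- `L^{(j)}`. [cite: Ford2002, proof of Lemma 3.3 (`∫ I(α)^{j} |f(α)|^{2s} dα`)] -/
def LI (j : ℕ) : ℕ := (LIset s P Q Φ q p r j).card

/-- Auxiliary step (elementary consequence of the standing hypotheses). [folklore] -/
theorem mem_LIset {j : ℕ} {a} : a ∈ LIset s P Q Φ q p r j ↔
    ((a.1.1 ∈ tuples j (Finset.Icc 1 (P : ℤ)) ∧ a.1.2 ∈ tuples s (Finset.Icc 1 (Q : ℤ))) ∧
      (a.2.1 ∈ tuples j (Finset.Icc 1 (P : ℤ)) ∧ a.2.2 ∈ tuples s (Finset.Icc 1 (Q : ℤ)))) ∧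
    (LfreqJ s Φ q j a.1 = LfreqJ s Φ q j a.2 ∧ ∀ i, ((p : ℤ) ^ r) ∣ a.1.1 i - a.2.1 i) := by
  rw [LIset, mem_filter, mem_product, mem_product, mem_product]

/-- `L_s(P,Q;Φ;p,q₀,r) = L^{(k)}` with moduli `q = p q₀`. [folklore] -/
theorem Ls_eq_LI (q₀ : ℤ) : Ls s P Q Φ p q₀ r = LI s P Q Φ ((p : ℤ) * q₀) p r k := rfl

/-! #### Residue classes and `I(α)` -/

/-- The class `{z ∈ [1,P] : z mod p^r = c}`. [cite: Ford2002, proof of Lemma 3.3 (`I(α)`)] -/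
def cls (c : ℤ) : Finset ℤ := (Finset.Icc 1 (P : ℤ)).filter fun z => z % (p : ℤ) ^ r = c

/-- `I(α) = ∑_c |∑_{w ∈ cls c} e(α·Φ(w))|² ≥ 0`. [cite: Ford2002, proof of Lemma 3.3 (`I(α)`)] -/
def Ifun (α : Fin k → ℝ) : ℝ := ∑ c ∈ Finset.Ico (0 : ℤ) ((p : ℤ) ^ r), ‖tp (cls P p r c) (sysv Φ) α‖ ^ 2

/-- Auxiliary step (elementary consequence of the standing hypotheses). [folklore] -/
theorem Ifun_nonneg (α : Fin k → ℝ) : 0 ≤ Ifun P Φ p r α := sum_nonneg fun c _ => by positivity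

/-- Auxiliary step (elementary consequence of the standing hypotheses). [folklore] -/
theorem continuous_Ifun : Continuous (Ifun P Φ p r) :=
  continuous_finsetSum _ fun _ _ => (continuous_tp _ _).norm.pow _

/-- The class vector sets `Z_{c⃗} = ∏_i cls(c_i)`. [folklore] -/
def Zcv {j : ℕ} (cv : Fin j → ℤ) : Finset (Fin j → ℤ) := Fintype.piFinset fun i => cls P p r (cv i)

/-- **`L^{(j)} = ∫ I(α)^j |f(α)|^{2s} dα`.** [cite: Ford2002, proof of Lemma 3.3 ("L = ∫ I(α)^k |f(α)|^{2s} dα")] -/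
theorem LI_eq_integral (hp : 0 < p) (j : ℕ) :
    (LI s P Q Φ q p r j : ℝ) = ∫ α in box k, Ifun P Φ p r α ^ j * absf Q q α ^ (2 * s) := by
  classical
  have hM : (0 : ℤ) < (p : ℤ) ^ r := by positivity
  set CL := Finset.Ico (0 : ℤ) ((p : ℤ) ^ r) with hCL
  set IQ := Finset.Icc 1 (Q : ℤ) with hIQ
  -- Step 1: fibre decomposition over the class vector of `z`
  have hstep1 : LI s P Q Φ q p r j = ∑ cv ∈ Fintype.piFinset (fun _ : Fin j => CL),
      ((((Zcv P p r cv) ×ˢ tuples s IQ) ×ˢ ((Zcv P p r cv) ×ˢ tuples s IQ)).filter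
        fun a => LfreqJ s Φ q j a.1 = LfreqJ s Φ q j a.2).card := by
    rw [LI, card_eq_sum_card_fiberwise (f := fun a => fun i => a.1.1 i % (p : ℤ) ^ r)
      (t := Fintype.piFinset fun _ : Fin j => CL)]
    swap
    · intro a _
      rw [mem_coe, Fintype.mem_piFinset]; intro i
      rw [hCL, Finset.mem_Ico]; exact ⟨Int.emod_nonneg _ hM.ne', Int.emod_lt_of_pos _ hM⟩
    refine sum_congr rfl fun cv _ => ?_
    congr 1
    ext a
    rw [mem_filter, mem_LIset, mem_filter, mem_product, mem_product, mem_product]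
    constructor
    · rintro ⟨⟨⟨⟨hz, hx⟩, hw, hy⟩, heq, hcong⟩, hcv⟩
      refine ⟨⟨⟨?_, hx⟩, ?_, hy⟩, heq⟩
      · rw [Zcv, Fintype.mem_piFinset]; intro i
        rw [cls, mem_filter]; exact ⟨mem_tuples.1 hz i, congrFun hcv i⟩
      · rw [Zcv, Fintype.mem_piFinset]; intro i
        rw [cls, mem_filter]
        refine ⟨mem_tuples.1 hw i, ?_⟩
        rw [← congrFun hcv i]
        -- `p^r ∣ z - w` gives `w ≡ z`
        exact (Int.modEq_iff_dvd.2 (hcong i) : a.2.1 i ≡ a.1.1 i [ZMOD (p : ℤ) ^ r])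
    · rintro ⟨⟨⟨hz, hx⟩, hw, hy⟩, heq⟩
      rw [Zcv, Fintype.mem_piFinset] at hz hw
      have hz' : ∀ i, a.1.1 i ∈ Finset.Icc (1 : ℤ) P ∧ a.1.1 i % (p : ℤ) ^ r = cv i := fun i => by
        have := hz i; rw [cls, mem_filter] at this; exact this
      have hw' : ∀ i, a.2.1 i ∈ Finset.Icc (1 : ℤ) P ∧ a.2.1 i % (p : ℤ) ^ r = cv i := fun i => by
        have := hw i; rw [cls, mem_filter] at this; exact this
      refine ⟨⟨⟨⟨mem_tuples.2 fun i => (hz' i).1, hx⟩, mem_tuples.2 fun i => (hw' i).1, hy⟩, heq, fun i => ?_⟩,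
        funext fun i => (hz' i).2⟩
      have : a.2.1 i % (p : ℤ) ^ r = a.1.1 i % (p : ℤ) ^ r := by rw [(hz' i).2, (hw' i).2]
      exact Int.ModEq.dvd this
  -- Step 2: each class-vector count is `∫ ‖∏ S_{c_i} · f^s‖²`
  have hstep2 : ∀ cv : Fin j → ℤ, (((((Zcv P p r cv) ×ˢ tuples s IQ) ×ˢ ((Zcv P p r cv) ×ˢ tuples s IQ)).filter
        fun a => LfreqJ s Φ q j a.1 = LfreqJ s Φ q j a.2).card : ℝ)
      = ∫ α in box k, (∏ i, ‖tp (cls P p r (cv i)) (sysv Φ) α‖ ^ 2) * absf Q q α ^ (2 * s) := by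
    intro cv
    rw [← integral_norm_sq_tp (n := k) ((Zcv P p r cv) ×ˢ tuples s IQ) (LfreqJ s Φ q j)]
    refine setIntegral_congr_fun (measurableSet_box k) fun α _ => ?_
    have e : tp ((Zcv P p r cv) ×ˢ tuples s IQ) (LfreqJ s Φ q j) α
        = tp (Zcv P p r cv) (tupSum (sysv Φ)) α * tp (tuples s IQ) (tupSum (powv k q)) α := by
      rw [tp_mul]; rfl
    have hz : tp (Zcv P p r cv) (tupSum (sysv Φ)) α = ∏ i, tp (cls P p r (cv i)) (sysv Φ) α := by
      have := prod_tp_eq (n := k) (m := j) (fun i => cls P p r (cv i)) (fun _ => sysv Φ) α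
      rw [this]; rfl
    rw [e, hz, tp_tuples_tupSum, norm_mul, norm_pow, mul_pow, Complex.norm_prod, ← prod_pow, ← pow_mul, absf,
      mul_comm s 2]
  -- Step 3: sum over class vectors inside the integral
  rw [hstep1]; push_cast
  simp_rw [hstep2]
  rw [← integral_finsetSum]
  swap
  · intro cv _
    refine integrableOn_box_of_continuous_real ?_
    exact (continuous_finsetProd _ fun i _ => (continuous_tp _ _).norm.pow _).mul ((continuous_tp _ _).norm.pow _)
  refine setIntegral_congr_fun (measurableSet_box k) fun α _ => ?_
  rw [← sum_mul]
  congr 1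
  rw [Ifun, ← Finset.prod_univ_sum (t := fun _ : Fin j => CL) (f := fun i c => ‖tp (cls P p r c) (sysv Φ) α‖ ^ 2),
    prod_const, card_univ, Fintype.card_fin]

/-! #### `U₀`: some `w_i = z_i` -/

/-- Simultaneous re-indexing of `z` and `w` preserves `LIset`. [folklore] -/
theorem comp_perm_mem_LIset {j : ℕ} (σ : Equiv.Perm (Fin j)) {a} (ha : a ∈ LIset s P Q Φ q p r j) :
    ((a.1.1 ∘ σ, a.1.2), (a.2.1 ∘ σ, a.2.2)) ∈ LIset s P Q Φ q p r j := by
  rw [mem_LIset] at ha ⊢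
  obtain ⟨⟨⟨hz, hx⟩, hw, hy⟩, heq, hcong⟩ := ha
  refine ⟨⟨⟨mem_tuples.2 fun i => mem_tuples.1 hz _, hx⟩, mem_tuples.2 fun i => mem_tuples.1 hw _, hy⟩, ?_,
    fun i => hcong _⟩
  simp only [LfreqJ] at heq ⊢
  have e : ∀ z : Fin j → ℤ, tupSum (sysv Φ) (z ∘ σ) = tupSum (sysv Φ) z := fun z => by
    simp only [tupSum]; exact Equiv.sum_comp σ (fun i => sysv Φ (z i))
  rw [e, e]; exact heq

/-- All the counts `#{z_i = w_i}` coincide. [folklore] -/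
theorem card_LIset_diag_eq {j : ℕ} (i i₀ : Fin j) :
    ((LIset s P Q Φ q p r j).filter fun a => a.1.1 i = a.2.1 i).card
      = ((LIset s P Q Φ q p r j).filter fun a => a.1.1 i₀ = a.2.1 i₀).card := by
  classical
  set σ : Equiv.Perm (Fin j) := Equiv.swap i₀ i with hσ
  have hσi : σ i₀ = i := by rw [hσ, Equiv.swap_apply_left]
  refine card_bij' (fun a _ => ((a.1.1 ∘ σ, a.1.2), (a.2.1 ∘ σ, a.2.2)))
    (fun a _ => ((a.1.1 ∘ σ.symm, a.1.2), (a.2.1 ∘ σ.symm, a.2.2))) ?_ ?_ ?_ ?_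
  · intro a ha
    rw [mem_filter] at ha ⊢
    refine ⟨comp_perm_mem_LIset s P Q Φ q p r σ ha.1, ?_⟩
    simp only [Function.comp_apply, hσi]; exact ha.2
  · intro a ha
    rw [mem_filter] at ha ⊢
    refine ⟨comp_perm_mem_LIset s P Q Φ q p r σ.symm ha.1, ?_⟩
    simp only [Function.comp_apply]
    rw [show σ.symm i = i₀ by rw [← hσi]; simp]; exact ha.2
  · intro a _; ext <;> simp
  · intro a _; ext <;> simp

/-- **`#{z_0 = w_0} ≤ P · L^{(j)}`** (split off the coordinate `0`). [cite: Ford2002, proof of Lemma 3.3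
("U₀ ≤ kP ∫ I(α)^{k−1} |f(α)|^{2s} dα")] -/
theorem card_LIset_diag0_le (j : ℕ) :
    ((LIset s P Q Φ q p r (j + 1)).filter fun a => a.1.1 0 = a.2.1 0).card ≤ P * LI s P Q Φ q p r j := by
  classical
  have h := card_le_card_of_injOn (s := (LIset s P Q Φ q p r (j + 1)).filter fun a => a.1.1 0 = a.2.1 0)
    (t := Finset.Icc 1 (P : ℤ) ×ˢ LIset s P Q Φ q p r j)
    (fun a => (a.1.1 0, ((fun i => a.1.1 i.succ, a.1.2), (fun i => a.2.1 i.succ, a.2.2)))) ?_ ?_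
  · rw [card_product, Int.card_Icc] at h
    rw [LI]; simpa using h
  · intro a ha
    rw [mem_coe, mem_filter, mem_LIset] at ha
    obtain ⟨⟨⟨⟨hz, hx⟩, hw, hy⟩, heq, hcong⟩, h0⟩ := ha
    rw [mem_coe, mem_product, mem_LIset]
    refine ⟨mem_tuples.1 hz 0, ⟨⟨mem_tuples.2 fun i => mem_tuples.1 hz _, hx⟩,
      mem_tuples.2 fun i => mem_tuples.1 hw _, hy⟩, ?_, fun i => hcong _⟩
    simp only [LfreqJ] at heq ⊢
    have e : ∀ z : Fin (j + 1) → ℤ, tupSum (sysv Φ) z = sysv Φ (z 0) + tupSum (sysv Φ) (fun i => z i.succ) := by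
      intro z; simp only [tupSum]; rw [Fin.sum_univ_succ]
    rw [e, e a.2.1, h0, add_assoc, add_assoc] at heq
    exact add_left_cancel heq
  · intro a ha b hb hab
    rw [mem_coe, mem_filter] at ha hb
    simp only [Prod.mk.injEq] at hab
    obtain ⟨h0, ⟨hz, hx⟩, hw, hy⟩ := hab
    refine Prod.ext (Prod.ext ?_ hx) (Prod.ext ?_ hy)
    · funext i; refine Fin.cases ?_ (fun i => ?_) i
      · exact h0
      · exact congrFun hz i
    · funext i; refine Fin.cases ?_ (fun i => ?_) i
      · rw [← ha.2, ← hb.2]; exact h0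
      · exact congrFun hw i

/-- **`U₀ ≤ j P L^{(j−1)}`** (`j = j' + 1`). [cite: Ford2002, proof of Lemma 3.3 ("L ≤ 2U₀ ≤ 2kP ∫ I^{k−1}|f|^{2s}")] -/
theorem card_U0_le (j : ℕ) :
    ((LIset s P Q Φ q p r (j + 1)).filter fun a => ∃ i, a.1.1 i = a.2.1 i).card
      ≤ (j + 1) * (P * LI s P Q Φ q p r j) := by
  classical
  have hcover : ((LIset s P Q Φ q p r (j + 1)).filter fun a => ∃ i, a.1.1 i = a.2.1 i)
      ⊆ (univ : Finset (Fin (j + 1))).biUnion fun i => (LIset s P Q Φ q p r (j + 1)).filter fun a => a.1.1 i = a.2.1 i := by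
    intro a ha
    rw [mem_filter] at ha
    obtain ⟨i, hi⟩ := ha.2
    rw [mem_biUnion]
    exact ⟨i, mem_univ _, by rw [mem_filter]; exact ⟨ha.1, hi⟩⟩
  refine (card_le_card hcover).trans (card_biUnion_le.trans ?_)
  calc ∑ i : Fin (j + 1), ((LIset s P Q Φ q p r (j + 1)).filter fun a => a.1.1 i = a.2.1 i).card
      = ∑ _i : Fin (j + 1), ((LIset s P Q Φ q p r (j + 1)).filter fun a => a.1.1 0 = a.2.1 0).card :=
        sum_congr rfl fun i _ => card_LIset_diag_eq s P Q Φ q p r i 0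
    _ ≤ ∑ _i : Fin (j + 1), P * LI s P Q Φ q p r j := sum_le_sum fun i _ => card_LIset_diag0_le s P Q Φ q p r j
    _ = (j + 1) * (P * LI s P Q Φ q p r j) := by rw [sum_const, card_univ, Fintype.card_fin, smul_eq_mul]

/-! #### Hölder: `L^{(k−1)} ≤ L^{1−1/k} J^{1/k}` -/

/-- `∫ I^{k−1} |f|^{2s} ≤ (∫ I^k |f|^{2s})^{1−1/k} (∫ |f|^{2s})^{1/k}` (`k ≥ 2`). [cite: Ford2002, proof of
Lemma 3.3 (the Hölder display in the case `U₀ ≥ U₁`)] -/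
theorem holder_I {n k s : ℕ} (hk : 2 ≤ k) {I φ : (Fin n → ℝ) → ℝ} (hI : Continuous I) (hφ : Continuous φ)
    (hI0 : ∀ α, 0 ≤ I α) (hφ0 : ∀ α, 0 ≤ φ α) :
    ∫ α in box n, I α ^ (k - 1) * φ α ^ (2 * s)
      ≤ (∫ α in box n, I α ^ k * φ α ^ (2 * s)) ^ (1 - 1 / (k : ℝ)) * (∫ α in box n, φ α ^ (2 * s)) ^ (1 / (k : ℝ)) := by
  have hkR : (2 : ℝ) ≤ k := by exact_mod_cast hk
  have hk0 : (0 : ℝ) < k := by linarith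
  have hk1 : (0 : ℝ) < k - 1 := by linarith
  have hkne : (k : ℝ) ≠ 0 := hk0.ne'
  have hk1ne : (k : ℝ) - 1 ≠ 0 := hk1.ne'
  set G₁ : (Fin n → ℝ) → ℝ := fun α => I α ^ (k - 1) * φ α ^ (2 * (s : ℝ) * (k - 1) / k) with hG₁
  set G₂ : (Fin n → ℝ) → ℝ := fun α => φ α ^ (2 * (s : ℝ) / k) with hG₂
  have hG₁0 : ∀ α, 0 ≤ G₁ α := fun α => mul_nonneg (pow_nonneg (hI0 α) _) (Real.rpow_nonneg (hφ0 α) _)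
  have hG₂0 : ∀ α, 0 ≤ G₂ α := fun α => Real.rpow_nonneg (hφ0 α) _
  have hG₁c : Continuous G₁ := (hI.pow _).mul (hφ.rpow_const fun _ => Or.inr (by positivity))
  have hG₂c : Continuous G₂ := hφ.rpow_const fun _ => Or.inr (by positivity)
  have hpq : ((k : ℝ) / (k - 1)).HolderConjugate (k : ℝ) := by
    rw [Real.holderConjugate_iff]
    refine ⟨by rw [lt_div_iff₀ hk1]; linarith, ?_⟩
    field_simp
    ring
  have hprod : ∀ α, I α ^ (k - 1) * φ α ^ (2 * s) = G₁ α * G₂ α := by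
    intro α
    simp only [hG₁, hG₂]
    have e : φ α ^ (2 * s) = φ α ^ (2 * (s : ℝ) * (k - 1) / k) * φ α ^ (2 * (s : ℝ) / k) := by
      rw [← Real.rpow_add_of_nonneg (hφ0 α) (by positivity) (by positivity),
        show (2 * (s : ℝ) * (k - 1) / k + 2 * (s : ℝ) / k) = ((2 * s : ℕ) : ℝ) by push_cast; field_simp; ring,
        Real.rpow_natCast]
    rw [e]; ring
  have step1 := holder_box hG₁c hG₂c hG₁0 hG₂0 hpq
  simp_rw [← hprod] at step1
  have hG₁pow : ∀ α, G₁ α ^ ((k : ℝ) / (k - 1)) = I α ^ k * φ α ^ (2 * s) := by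
    intro α
    simp only [hG₁]
    rw [Real.mul_rpow (pow_nonneg (hI0 α) _) (Real.rpow_nonneg (hφ0 α) _), ← Real.rpow_natCast,
      ← Real.rpow_mul (hI0 α), ← Real.rpow_mul (hφ0 α)]
    have e1 : ((k - 1 : ℕ) : ℝ) * ((k : ℝ) / (k - 1)) = ((k : ℕ) : ℝ) := by
      rw [Nat.cast_sub (by omega)]; push_cast; field_simp
    have e2 : 2 * (s : ℝ) * (k - 1) / k * ((k : ℝ) / (k - 1)) = ((2 * s : ℕ) : ℝ) := by
      push_cast; field_simp
    rw [e1, e2, Real.rpow_natCast, Real.rpow_natCast]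
  have hG₂pow : ∀ α, G₂ α ^ (k : ℝ) = φ α ^ (2 * s) := by
    intro α
    simp only [hG₂]
    rw [← Real.rpow_mul (hφ0 α)]
    have e : 2 * (s : ℝ) / k * k = ((2 * s : ℕ) : ℝ) := by push_cast; field_simp
    rw [e, Real.rpow_natCast]
  simp_rw [hG₁pow, hG₂pow] at step1
  have e3 : 1 / ((k : ℝ) / (k - 1)) = 1 - 1 / (k : ℝ) := by field_simp
  rw [e3] at step1
  exact step1

/-- **Case `U₀`:** `L^{(k−1)} ≤ L^{1−1/k} J_{s,k}(Q)^{1/k}` (moduli `q ≠ 0`, `k ≥ 2`). [cite: Ford2002, proof of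
Lemma 3.3 ("= 2kP L^{1−1/k} J_{s,k}(Q)^{1/k}")] -/
theorem LI_pred_le {k' : ℕ} (s P Q : ℕ) (Φ : PSystem (k' + 2)) {q : ℤ} (hq : q ≠ 0) (p r : ℕ) (hp : 0 < p) :
    (LI s P Q Φ q p r (k' + 1) : ℝ)
      ≤ (LI s P Q Φ q p r (k' + 2) : ℝ) ^ (1 - 1 / ((k' : ℝ) + 2))
        * (J (k' + 2) s (Finset.Icc 1 (Q : ℤ)) : ℝ) ^ (1 / ((k' : ℝ) + 2)) := by
  rw [LI_eq_integral s P Q Φ q p r hp, LI_eq_integral s P Q Φ q p r hp, J_eq_integral_absf s Q (k := k' + 2) hq]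
  have h := holder_I (n := k' + 2) (k := k' + 2) (s := s) (by omega) (continuous_Ifun P Φ p r) (continuous_absf Q q)
    (Ifun_nonneg P Φ p r) (absf_nonneg Q q)
  rw [show k' + 2 - 1 = k' + 1 by omega] at h
  have e : ((k' + 2 : ℕ) : ℝ) = (k' : ℝ) + 2 := by push_cast; ring
  rw [e] at h
  exact h

end LCounts

end FordVK
end Literature.NumberTheory.LFunctions
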